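import Mathlib
import HarnessLib
import Summits.Ventures.LatticeQCDFlow.Scaling.AutoregressiveGaugeColdEscapeRatio
import Summits.Ventures.LatticeQCDFlow.Scaling.AutoregressiveGaugeHeatBathClosingMapLaw
import Summits.Ventures.LatticeQCDFlow.Scaling.TorusPlaquetteLastLinks

/-!
# LatticeQCDFlow / Scaling — exponential-in-volume separation of the two exact samplers at the cold start:
# `A_heat-bath(cold) ≤ (c₂/(cM))^{#closers} · A_all-closing(cold)`, `#closers ≥ k/(2d−3)`

HONEST FRAMING: exact (Metropolis-corrected) sampling algorithms for lattice gauge theory;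
figures of merit are autocorrelation/cost numbers at stated couplings and volumes; no
continuum-physics claim.

Venture `LatticeQCDFlow` (cell pub-lqcd), topic `Scaling`, FANOUT row 30 (lean-1, GEN-28) — OUR WORK on
THEORY-2.md §4 row C5.  `AutoregressiveGaugeColdEscapeRatio`: along a ranked structure `(B, t)` with a total
closing map `u : Bᶜ → B`, the exact cold acceptance masses of the one-plaquette heat bath and of the
all-closing conditioner (induced assignment) satisfy `A_hb(cold) = η · A_all(cold)`,
`η = ∏_{a∈B} c_{n_a+1}/(c M^{n_a})`.  `AutoregressiveGaugeHeatBathClosingMapLaw.prod_ratio_le_twoWeight_pow`: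
`η ≤ θ₁^{#u(Bᶜ)}`, `θ₁ = c₂/(cM)` the two-plaquette ratio (`< 1` for non-constant `w`).  Here the number of
distinct closers is bounded below by the geometry of the torus:

* §1 **`card_fibre_le`** — a closer `a` closes at most `2(d−1) − 1` uncovered plaquettes (all of them, and `a`
  itself, contain the link `t(a)`, which lies on at most `2(d−1)` plaquettes,
  `TorusPlaquetteLastLinks.card_filter_mem_plaquetteLinks_le`); hence (**`card_compl_le_mul_card_closers`**)
  `k = #Bᶜ ≤ (2(d−1) − 1)·#u(Bᶜ)`;
* §2 **`eta_le_twoWeight_pow_closers`** — `η ≤ θ₁^{#u(Bᶜ)}` with `(2(d−1)−1)·#u(Bᶜ) ≥ k`;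
* §3 **`cold_acceptMass_separation`** — THE SEPARATION: `A_hb(cold) ≤ θ₁^{#u(Bᶜ)} · A_all(cold)` with
  `#u(Bᶜ) ≥ k/(2d−3)`; for an optimal structure `k = k_min(d, L) = (d−1)(d−2)/2·L^d + (d−1)`, so by
  `AutoregressiveGaugeUniformRateExact` the uniform convergence rate gap of the exact one-plaquette heat bath
  is smaller than that of the all-closing sampler on the same structure by a factor decaying EXPONENTIALLY IN
  THE VOLUME whenever `w` is not constant (`θ₁ < 1`, `AutoregressiveGaugeHeatBathClosingMapFloor.ratio_lt_one`).

NOT CLAIMED: that the all-closing sampler itself is fast (its own rate `Z/∏_ℓ c_{#C_ℓ}` is not bounded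
below here), nor anything about non-optimal proposals.
No `def`, no `sorry`, nothing cited as a fact beyond the tree.
-/

noncomputable section

namespace Summit.Ventures.LatticeQCDFlow.Theory2.Autoregressive

open MeasureTheory ProbabilityTheory Function Finset
open scoped ENNReal
open Literature.MathematicalPhysics.QuantumFieldTheory Literature.MathematicalPhysics.QuantumLattice
open Summit.Ventures.LatticeQCDFlow.Exactness Summit.Ventures.LatticeQCDFlow.Scoring

variable {d L : ℕ} [NeZero L]

/-! ## §1 A closer closes at most `2(d−1) − 1` uncovered plaquettes -/

/-- **`n_a ≤ 2(d−1) − 1`**: the uncovered plaquettes closed by `a ∈ B` and `a` itself all contain the link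
`t(a)`, which lies on at most `2(d−1)` plaquettes. [ours] -/
theorem card_fibre_le (B : Finset (Plaquette d L)) (t : Plaquette d L → Edge d L)
    (ht : ∀ p ∈ B, t p ∈ ({(p.1, p.2.1.1), (p.1.shift p.2.1.1, p.2.1.2),
        (p.1.shift p.2.1.2, p.2.1.1), (p.1, p.2.1.2)} : Finset (Edge d L)))
    (u : Plaquette d L → Plaquette d L)
    (hut : ∀ p' ∈ Finset.univ \ B, t (u p') ∈ ({(p'.1, p'.2.1.1), (p'.1.shift p'.2.1.1, p'.2.1.2),
        (p'.1.shift p'.2.1.2, p'.2.1.1), (p'.1, p'.2.1.2)} : Finset (Edge d L)))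
    {a : Plaquette d L} (ha : a ∈ B) :
    ((Finset.univ \ B).filter (fun p' => u p' = a)).card ≤ 2 * (d - 1) - 1 := by
  classical
  have hsub : insert a ((Finset.univ \ B).filter (fun p' => u p' = a)) ⊆
      (Finset.univ : Finset (Plaquette d L)).filter (fun p => t a ∈
        ({(p.1, p.2.1.1), (p.1.shift p.2.1.1, p.2.1.2), (p.1.shift p.2.1.2, p.2.1.1), (p.1, p.2.1.2)} :
          Finset (Edge d L))) := by
    intro p hp
    rw [Finset.mem_insert] at hp
    rw [Finset.mem_filter]
    rcases hp with rfl | hp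
    · exact ⟨Finset.mem_univ _, ht _ ha⟩
    · obtain ⟨hp', hpu⟩ := Finset.mem_filter.1 hp
      exact ⟨Finset.mem_univ _, hpu ▸ hut p hp'⟩
  have hnot : a ∉ (Finset.univ \ B).filter (fun p' => u p' = a) := fun h =>
    (Finset.mem_sdiff.1 (Finset.mem_filter.1 h).1).2 ha
  have h1 := Finset.card_le_card hsub
  rw [Finset.card_insert_of_notMem hnot] at h1
  have h2 := card_filter_mem_plaquetteLinks_le (t a)
  omega

/-- **`k = #Bᶜ ≤ (2(d−1) − 1) · #u(Bᶜ)`** for a total closing map. [ours] -/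
theorem card_compl_le_mul_card_closers (B : Finset (Plaquette d L)) (t : Plaquette d L → Edge d L)
    (ht : ∀ p ∈ B, t p ∈ ({(p.1, p.2.1.1), (p.1.shift p.2.1.1, p.2.1.2),
        (p.1.shift p.2.1.2, p.2.1.1), (p.1, p.2.1.2)} : Finset (Edge d L)))
    (u : Plaquette d L → Plaquette d L) (huB : ∀ p' ∈ Finset.univ \ B, u p' ∈ B)
    (hut : ∀ p' ∈ Finset.univ \ B, t (u p') ∈ ({(p'.1, p'.2.1.1), (p'.1.shift p'.2.1.1, p'.2.1.2),
        (p'.1.shift p'.2.1.2, p'.2.1.1), (p'.1, p'.2.1.2)} : Finset (Edge d L))) :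
    (Finset.univ \ B).card ≤ (2 * (d - 1) - 1) * ((Finset.univ \ B).image u).card := by
  classical
  rw [Finset.card_eq_sum_card_fiberwise (t := (Finset.univ \ B).image u)
    (fun p' hp' => Finset.mem_image_of_mem u hp')]
  calc ∑ a ∈ (Finset.univ \ B).image u, ((Finset.univ \ B).filter (fun p' => u p' = a)).card
      ≤ ∑ _a ∈ (Finset.univ \ B).image u, (2 * (d - 1) - 1) :=
        Finset.sum_le_sum fun a ha => by
          obtain ⟨p', hp', rfl⟩ := Finset.mem_image.1 ha
          exact card_fibre_le B t ht u hut (huB p' hp')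
    _ = (2 * (d - 1) - 1) * ((Finset.univ \ B).image u).card := by
        rw [Finset.sum_const, smul_eq_mul, mul_comm]

/-! ## §2 `η ≤ θ₁^{#closers}` with `#closers ≥ k/(2d−3)` -/

section Haar

variable {G : Type*} [Group G] [TopologicalSpace G] [IsTopologicalGroup G]
  [CompactSpace G] [MeasurableSpace G] [BorelSpace G]

/-- **`η ≤ θ₁^{#u(Bᶜ)}` and `(2(d−1) − 1)·#u(Bᶜ) ≥ k`.** [ours] -/
theorem eta_le_twoWeight_pow_closers {w : G → ℝ} (hw : Continuous w) (hw0 : ∀ g, 0 < w g) {M : ℝ}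
    (hM : ∀ g, w g ≤ M) (B : Finset (Plaquette d L)) (t : Plaquette d L → Edge d L)
    (ht : ∀ p ∈ B, t p ∈ ({(p.1, p.2.1.1), (p.1.shift p.2.1.1, p.2.1.2),
        (p.1.shift p.2.1.2, p.2.1.1), (p.1, p.2.1.2)} : Finset (Edge d L)))
    (u : Plaquette d L → Plaquette d L) (huB : ∀ p' ∈ Finset.univ \ B, u p' ∈ B)
    (hut : ∀ p' ∈ Finset.univ \ B, t (u p') ∈ ({(p'.1, p'.2.1.1), (p'.1.shift p'.2.1.1, p'.2.1.2),
        (p'.1.shift p'.2.1.2, p'.2.1.1), (p'.1, p'.2.1.2)} : Finset (Edge d L))) :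
    (∏ a ∈ B, (∫ h, w h ^ (((Finset.univ \ B).filter (fun p' => u p' = a)).card + 1) ∂(haarProbability G)) /
        ((∫ g, w g ∂(haarProbability G)) * M ^ ((Finset.univ \ B).filter (fun p' => u p' = a)).card)) ≤
      ((∫ h, w h ^ 2 ∂(haarProbability G)) / ((∫ g, w g ∂(haarProbability G)) * M)) ^
        ((Finset.univ \ B).image u).card ∧
    (Finset.univ \ B).card ≤ (2 * (d - 1) - 1) * ((Finset.univ \ B).image u).card := by
  have h := prod_ratio_le_twoWeight_pow hw hw0 hM B u huB
  rw [pow_one] at h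
  exact ⟨h, card_compl_le_mul_card_closers B t ht u huB hut⟩

end Haar

/-! ## §3 The separation of the two exact cold escape rates -/

section Separation

variable {G : Type*} [Group G] [TopologicalSpace G] [IsTopologicalGroup G]
  [CompactSpace G] [SecondCountableTopology G] [MeasurableSpace G] [BorelSpace G]

/-- **EXPONENTIAL SEPARATION AT THE COLD START.**  Setting of
`AutoregressiveGaugeColdEscapeRatio.cold_acceptMass_heatBath_eq_eta_mul_allClosing` (ranked `(B, t, rank)`,
total closing map `u`, `0 < m ≤ w ≤ M = w(1)`, `w(g⁻¹) = w(g)`; heat-bath proposal `q_B`, all-closing proposal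
`q` along the induced assignment).  Then `A_hb(cold) ≤ θ₁^{#u(Bᶜ)} · A_all(cold)`, `θ₁ = c₂/(cM)`, and
`(2(d−1) − 1)·#u(Bᶜ) ≥ k = #Bᶜ`. [ours] -/
theorem cold_acceptMass_separation (hL : 2 ≤ L) {w : G → ℝ} (hw : Continuous w)
    {m M : ℝ} (hm0 : 0 < m) (hm : ∀ g, m ≤ w g) (hM : ∀ g, w g ≤ M) (hw1 : w 1 = M) (hwinv : ∀ g, w g⁻¹ = w g)
    (B : Finset (Plaquette d L)) (t : Plaquette d L → Edge d L)
    (ht : ∀ p ∈ B, t p ∈ ({(p.1, p.2.1.1), (p.1.shift p.2.1.1, p.2.1.2),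
        (p.1.shift p.2.1.2, p.2.1.1), (p.1, p.2.1.2)} : Finset (Edge d L)))
    (rank : Plaquette d L → ℕ)
    (hrank : ∀ p ∈ B, ∀ p' ∈ B, p ≠ p' → t p ∈ ({(p'.1, p'.2.1.1), (p'.1.shift p'.2.1.1, p'.2.1.2),
        (p'.1.shift p'.2.1.2, p'.2.1.1), (p'.1, p'.2.1.2)} : Finset (Edge d L)) → rank p < rank p')
    (u : Plaquette d L → Plaquette d L) (huB : ∀ p' ∈ Finset.univ \ B, u p' ∈ B)
    (hut : ∀ p' ∈ Finset.univ \ B, t (u p') ∈ ({(p'.1, p'.2.1.1), (p'.1.shift p'.2.1.1, p'.2.1.2),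
        (p'.1.shift p'.2.1.2, p'.2.1.1), (p'.1, p'.2.1.2)} : Finset (Edge d L)))
    (π qB q : Measure (GaugeConfig d L G)) [IsProbabilityMeasure π] [IsProbabilityMeasure qB]
    [IsProbabilityMeasure q]
    (hπ : π = (Measure.pi fun _ : Edge d L => haarProbability G).withDensity fun U =>
      ENNReal.ofReal ((∏ p : Plaquette d L, w (plaquetteHolonomy U p.1 p.2.1.1 p.2.1.2)) /
        ∫ V, ∏ p : Plaquette d L, w (plaquetteHolonomy V p.1 p.2.1.1 p.2.1.2) ∂(Measure.pi fun _ : Edge d L => haarProbability G)))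
    (hqB : qB = (Measure.pi fun _ : Edge d L => haarProbability G).withDensity fun U =>
      ENNReal.ofReal ((∏ p ∈ B, w (plaquetteHolonomy U p.1 p.2.1.1 p.2.1.2)) /
        ∫ V, ∏ p ∈ B, w (plaquetteHolonomy V p.1 p.2.1.1 p.2.1.2) ∂(Measure.pi fun _ : Edge d L => haarProbability G)))
    (hq : q = (Measure.pi fun _ : Edge d L => haarProbability G).withDensity fun U =>
      ENNReal.ofReal (∏ ℓ ∈ B.image t,
        (∏ p ∈ B.filter (fun b => t b = ℓ) ∪ (Finset.univ \ B).filter (fun p' => t (u p') = ℓ),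
            w (plaquetteHolonomy U p.1 p.2.1.1 p.2.1.2)) /
          (∫ v, ∏ p ∈ B.filter (fun b => t b = ℓ) ∪ (Finset.univ \ B).filter (fun p' => t (u p') = ℓ),
            w (plaquetteHolonomy (update U ℓ v) p.1 p.2.1.1 p.2.1.2) ∂(haarProbability G)))) :
    (imhAcceptMass qB (fun U =>
        ((∫ V, ∏ p : Plaquette d L, w (plaquetteHolonomy V p.1 p.2.1.1 p.2.1.2) ∂(Measure.pi fun _ : Edge d L => haarProbability G)) /
          ((∫ V, ∏ p ∈ B, w (plaquetteHolonomy V p.1 p.2.1.1 p.2.1.2) ∂(Measure.pi fun _ : Edge d L => haarProbability G)) *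
            ∏ p ∈ Finset.univ \ B, w (plaquetteHolonomy U p.1 p.2.1.1 p.2.1.2)))⁻¹)
        (fun _ : Edge d L => (1 : G))).toReal ≤
      ((∫ h, w h ^ 2 ∂(haarProbability G)) / ((∫ g, w g ∂(haarProbability G)) * M)) ^
        ((Finset.univ \ B).image u).card *
      (imhAcceptMass q (fun U =>
        (((∫ V, ∏ p : Plaquette d L, w (plaquetteHolonomy V p.1 p.2.1.1 p.2.1.2) ∂(Measure.pi fun _ : Edge d L => haarProbability G)) /
          ∏ ℓ ∈ B.image t, (∫ v, ∏ p ∈ B.filter (fun b => t b = ℓ) ∪ (Finset.univ \ B).filter (fun p' => t (u p') = ℓ),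
            w (plaquetteHolonomy (update U ℓ v) p.1 p.2.1.1 p.2.1.2) ∂(haarProbability G))))⁻¹)
        (fun _ : Edge d L => (1 : G))).toReal ∧
    (Finset.univ \ B).card ≤ (2 * (d - 1) - 1) * ((Finset.univ \ B).image u).card := by
  have hw0 : ∀ g, 0 < w g := fun g => hm0.trans_le (hm g)
  obtain ⟨hη, hk⟩ := eta_le_twoWeight_pow_closers (G := G) hw hw0 hM B t ht u huB hut
  refine ⟨?_, hk⟩
  rw [cold_acceptMass_heatBath_eq_eta_mul_allClosing hL hw hm0 hm hM hw1 hwinv B t ht rank hrank u huB hut π qB q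
    hπ hqB hq]
  exact mul_le_mul_of_nonneg_right hη ENNReal.toReal_nonneg

omit [SecondCountableTopology G] in
/-- **… and the factor is `< 1` to a power `≥ k/(2d−3)` as soon as `w` is not constant** (`θ₁ < 1`,
`AutoregressiveGaugeHeatBathClosingMapFloor.ratio_lt_one`), with `θ₁ ≤ 1` always: for an OPTIMAL structure,
`k = k_min(d, L) = (d−1)(d−2)/2·L^d + (d−1)`, the heat bath's cold escape rate — its exact uniform convergence
gap — is exponentially smaller in the volume than the all-closing sampler's. [ours] -/
theorem twoWeight_ratio_pow_lt_one {w : G → ℝ} (hw : Continuous w) (hw0 : ∀ g, 0 < w g) {M : ℝ}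
    (hM : ∀ g, w g ≤ M) {g₀ : G} (hg₀ : w g₀ < M) {s : ℕ} (hs : 1 ≤ s) :
    ((∫ h, w h ^ 2 ∂(haarProbability G)) / ((∫ g, w g ∂(haarProbability G)) * M)) ^ s < 1 := by
  have h1 : (∫ h, w h ^ 2 ∂(haarProbability G)) / ((∫ g, w g ∂(haarProbability G)) * M) < 1 := by
    have h := ratio_lt_one hw hw0 hM hg₀ 0
    rwa [zero_add, pow_one] at h
  have h0 : 0 ≤ (∫ h, w h ^ 2 ∂(haarProbability G)) / ((∫ g, w g ∂(haarProbability G)) * M) :=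
    div_nonneg (integral_nonneg fun h => sq_nonneg _)
      (mul_nonneg (integral_nonneg fun g => (hw0 g).le) ((hw0 1).le.trans (hM 1)))
  exact pow_lt_one₀ h0 h1 (by omega)

end Separation

end Summit.Ventures.LatticeQCDFlow.Theory2.Autoregressive

end
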